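import Literature.MathematicalPhysics.QuantumFieldTheory.Balaban1983to89.B9Eq315QTowerLipschitz

/-!
# `Balaban1983to89.B9Eq319QprimeTowerLipschitzL2` — T. Bałaban, *Propagators for lattice gauge theories in a background field*, Commun. Math. Phys. **99**
# (1985) 389–434 [Balaban1985BackgroundPropagators] (3.19) p. 393 (the composite gauge-parameter averaging `Q′_k(U) = Q′(Ū^{k−1})⋯Q′(U)`), (3.11) p. 392,
# p. 403 («satisfy the same bounds»), (3.79)–(3.81) p. 406, with [Balaban1985Averaging] (2)–(4) pp. 17–18: **THE TOWER LETTER `ρ′_k` IN THE `ℓ²` CURRENCY —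
# `√(Σ_y ‖(Q′_k(R)λ − Q′_k(1)λ)(y)‖²) ≤ (Π_{j<k}(1 + ρ(ε_j)) − 1)·(√(L^{−d}))^k·√(Σ_x ‖λ(x)‖²)`, `ρ(ε) = (1+ε)^{d(L−1)} − 1`** — the `ℓ²` telescoping of
# ne9-leaf-03's one-step Hilbert letter (`B9Eq319QprimeLipschitz.sum_norm_sq_QprimeLin_sub_flat_le`): NO `(√c₀)⁻¹ = L^{kd∕2}`, NO volume; on the chain's carrier
# `√(Σ_y‖(Q′_k(U)λ − Q′_k(1)λ)(y)‖²) ≤ (Π(1 + ρ′_j) − 1)·√((c₀L^{kd})⁻¹)·‖λ‖_{L²(c₀)}` — `= (Π − 1)‖λ‖` at print's `c₀L^{kd} = (ηL^k)^d = 1`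

statement-level skeleton of published theorems with citation tags; proofs where landed; nothing here is a claim about the Yang–Mills mass gap

PDF held: `paper:balaban1985-cmp99-background-propagators` (journal page = PDF page + 388) p. 393 (text layer p0005) and p. 396 (p0008) read by this seat
(2026-08-22); pp. 403, 406 and [Balaban1985Averaging] pp. 17–18 through the verbatim quotations of the tree's `B9Eq319QprimeLipschitz` ∕ `B9Eq315QTowerLipschitz`.
THE PRINT (verbatim).  [B9] p. 393: *«Q′_j(U) = Q′(Ū^{j−1}) … Q′(Ū)Q′(U)»* (3.19), the one-step *«(Q′(V)λ)(y) = Σ_{x∈B(y)} L^{−d} R(V(Γ_{y,x}))λ(x)»*; p. 403: the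
averaging and projection operators at `U` *«satisfy the same bounds»* as at `U = 1`; [B7] (4) p. 18: the blocks partition the lattice.

WHY THIS FILE (cell context; OFFER O-ne9leaf02-g64-3 (a) of the pub-balaban NE9 crux team).  The chain's tower letter `ρ′_k`
(`B9Eq315QTowerLipschitz.norm_QprimeTowerW_sub_flat_le`, `…Profile` §3) is a SUP letter with the `L²` norm on the right: `‖Q′_k(U)λ − Q′_k(1)λ‖_∞ ≤
ρ′·(√c₀)⁻¹·‖λ‖_{L²(c₀)}`; along print's (3.11)∕(3.16) (`c₀ = η^d = L^{−kd}` at `ηL^k = 1`) the factor `(√c₀)⁻¹` is `L^{kd∕2}` — exponential in the number of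
levels — and the host `B9Thm311SmallFieldCoercivityTower.exists_coercive_principalk_of_small_field` multiplies it by the sections' sup→`L²` constant
`CS = L^{kd∕2}√#T_m` (this lineage's journal audit R-ne9leaf02-g64-1).  ne9-leaf-03's one-step letter already exists in the HILBERT currency
(`sum_norm_sq_QprimeLin_sub_flat_le`: `Σ_y‖ΔQ′λ(y)‖² ≤ ρ(ε)²·L^{−d}·Σ_x‖λ x‖²`, Jensen on the blocks + the block partition); THIS FILE telescopes it along
the tower in `ℓ²`: since the deviation carries the SAME `L^{−d∕2}` as the flat block mean, the normalised deviation obeys `1 + E′_{n+1} ≤ (1 + E′_n)(1 + ρ_n)`,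
so `E′_k ≤ Π_{j<k}(1 + ρ_j) − 1` — free of every volume, the number of levels entering only through `Π_j(1 + ρ_j) ≤ exp(Σ_j ρ_j)` (bounded under the
ε-profile).  Companion of this lineage's `B9Eq315QTowerLipschitzL2` (the vector averaging `Q_k`).

WHAT IS PROVED (sorry-free; proof lane — no `def`, no `Prop` placeholder, no inequality of the papers asserted hypothesis-free).
* §1 [folklore] Minkowski in `ℓ²` for finite families (private); **`sum_norm_sq_QprimeLin_flat_le`** — the flat one-step `Q′(1)` is an `ℓ²`-contraction
  by `L^{−d∕2}`: `Σ_y ‖(Q′(1)λ)(y)‖² ≤ L^{−d}·Σ_x ‖λ x‖²` (Jensen `blockMean_norm_sq_le` + the partition `sum_blockOf_sum`).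
* §2 **`sqrt_sum_norm_sq_QprimeTower_flat_le`** (`√Σ‖Q′_n(1)λ‖² ≤ (√(L^{−d}))^n √Σ‖λ‖²`) and **`sqrt_sum_norm_sq_QprimeTower_sub_id_le`** — THE `ℓ²`
  TELESCOPING for a level family of `ℂ`-linear bond transporters `ε_j`-close to the identity:
  `√(Σ_y ‖(Q′_n(R)λ − Q′_n(1)λ)(y)‖²) ≤ (Π_{j<n}(1 + ρ(ε_j)) − 1)·(√(L^{−d}))^n·√(Σ_x ‖λ x‖²)`.
* §3 THE READING ON THE CHAIN's CARRIER `QprimeTowerW` (transporters `R(Ū^j(b))`, `2M_φM_φ′ε_j`-close to the identity by `norm_adTransportW_sub_le`):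
  **`sqrt_sum_norm_sq_QprimeTowerW_sub_flat_le`** — `√(Σ_y ‖(Q′_k(U)λ − Q′_k(1)λ)(y)‖²) ≤ (Π_{j≤n}(1 + 2M_φM_φ′ε_j)^{d(L−1)} − 1)·√((c₀·(L^{n+1})^d)⁻¹)·‖λ‖_{L²(c₀)}`
  (LEFT-HAND SIDE: the coarse `ℓ²` norm of the SAME difference `B9Eq315QTowerLipschitz.norm_QprimeTowerW_sub_flat_le` bounds in sup norm);
  **`…_geometric`** (restricted ε-profile `ε_j ≤ ε⋆r^j`, `j < n+1` ⇒ `Π ≤ exp(d(L−1)·2M_φM_φ′ε⋆∕(1−r))`, FREE OF THE NUMBER OF LEVELS AND OF EVERY VOLUME).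
* §4 THE WEIGHT-`c₁` READINGS `Q̃′_k(U) := (L²(c₁)-bundling) ∘ Q′_k(U)` (the letters `θ_Q`, `M_Q` of the NE9 owner g85's W-3; k-level twins of
  `B9Eq325RLipschitzResolvent.norm_Qtilde_sub_Qtilde_le` ∕ `norm_Qtilde_one_le`): **`norm_QtildeTower_sub_flat_le`** (`≤ (Π − 1)·√(c₁∕(c₀L^{kd}))·‖λ‖`),
  **`norm_QtildeTower_one_le`** (`≤ √(c₁∕(c₀L^{kd}))·‖λ‖`) — `√(c₁∕(c₀L^{kd})) = (ηL^k)⁻¹` along (3.16).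
MODEL ∕ DECLARED READINGS.  (M1) those of `B9Eq315QTowerLipschitz(Profile)`: the bond smallness `ε_j` and unit-boundedness of the level backgrounds
`UlevOf L m (n+1) U j` DISPLAYED (`hUε`, `hUb`) — the gauge question; (M2) `√((c₀L^{kd})⁻¹) = 1` along (3.11)∕(3.16) (`c₀ = η^d`, `ηL^k = 1`) — NOT a volume;
(M3) the coarse norm is the UNWEIGHTED `ℓ²` over `T_m` (weight `(ηL^k)^d = 1` in print), stated as `√Σ_y‖·‖²` on the plain function space.
HONEST SCOPE.  [folklore] `ℓ²` telescoping of a landed one-step Hilbert letter; the host's displays `(S₁, S₂, CS, ρ′)` are NOT re-typed here (that is the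
owner's file — journal ASK (d) of O-3); nothing of [B9] Lemma 3.1 ∕ (3.37); NOT summit progress (cell pub-balaban: NE9 NOT PRINTED ∕ NOT PROVED, «NE9 ⇐ the
named binders»; row WALLED ON A MODEL; spine PROVED 0∕9; rung (B)+1 finite T⁴ — NOT infinite volume, NOT mass gap, NOT Clay; HONEST DEPENDENCY: continuum YM
on T⁴ ⇐ BetaPertH ∧ nine spine estimates (0/9 proved); BetaPertH ⇐ (D1) ∧ (D4) ∧ CAP+tail; G-an2-4 gates asym, D1 and NE2/3/4).  Filed by the NE9
crux-team leaf seat `b2b-balaban-t4-ne9-formalise-leaf-02` (gen 64); NEW file importing `B9Eq315QTowerLipschitz` only; nothing of the owner's ∕ leaf-03's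
files modified or restated.  Net new unproved facts: 0.
-/

noncomputable section

open scoped BigOperators

namespace Literature.MathematicalPhysics.QuantumFieldTheory.Balaban1983to89.B9Eq319QprimeTowerLipschitzL2

open B4Sect5Torus (TSite)
open B9SectCLatticeCarrier (Bond)
open B7Prop1Explicit (U1)
open B9Eq311L2Pairing (WL2)
open B11Eq103H1Complex (SiteL2K)
open B9Eq319QprimeTorus (fineP QprimeLin)
open B9Eq319QprimeLipschitz (QprimeLin_flat_apply blockMean_norm_sq_le sum_blockOf_sum sum_norm_sq_QprimeLin_sub_flat_le rho_nonneg)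
open B9Eq315QTower (towerP UlevOf QprimeTower QprimeTower_succ)
open B9Eq315QTowerFlat (UlevOf_one)
open B9Eq326OperatorTower (QprimeTowerW)
open B9Eq310HessianOperator (adTransportW)
open B5Eq172HodgePositivity (adTransportW_one)
open B9Eq384RemainderLetters (norm_adTransportW_sub_le)

variable {d : ℕ} (L : ℕ) [NeZero L]

/-! ## §1 Minkowski in `ℓ²`; the flat one-step `Q′(1)` is an `ℓ²`-contraction by `L^{−d∕2}` -/

omit [NeZero L] in
/-- `√(Σ ‖x_b + y_b‖²) ≤ √(Σ ‖x_b‖²) + √(Σ ‖y_b‖²)`. [folklore] -/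
private theorem sqrt_sum_norm_add_sq_le {ι : Type*} [Fintype ι] {E : Type*} [SeminormedAddCommGroup E] (x y : ι → E) :
    Real.sqrt (∑ b, ‖x b + y b‖ ^ 2) ≤ Real.sqrt (∑ b, ‖x b‖ ^ 2) + Real.sqrt (∑ b, ‖y b‖ ^ 2) := by
  have hX : 0 ≤ Real.sqrt (∑ b, ‖x b‖ ^ 2) := Real.sqrt_nonneg _
  have hY : 0 ≤ Real.sqrt (∑ b, ‖y b‖ ^ 2) := Real.sqrt_nonneg _
  have hcs : ∑ b, ‖x b‖ * ‖y b‖ ≤ Real.sqrt (∑ b, ‖x b‖ ^ 2) * Real.sqrt (∑ b, ‖y b‖ ^ 2) := Real.sum_mul_le_sqrt_mul_sqrt _ _ _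
  rw [Real.sqrt_le_left (by positivity)]
  calc ∑ b, ‖x b + y b‖ ^ 2 ≤ ∑ b, (‖x b‖ + ‖y b‖) ^ 2 :=
        Finset.sum_le_sum fun b _ => pow_le_pow_left₀ (norm_nonneg _) (norm_add_le _ _) 2
    _ = ∑ b, ‖x b‖ ^ 2 + 2 * ∑ b, ‖x b‖ * ‖y b‖ + ∑ b, ‖y b‖ ^ 2 := by
        rw [Finset.mul_sum, ← Finset.sum_add_distrib, ← Finset.sum_add_distrib]
        exact Finset.sum_congr rfl fun b _ => by ring
    _ ≤ ∑ b, ‖x b‖ ^ 2 + 2 * (Real.sqrt (∑ b, ‖x b‖ ^ 2) * Real.sqrt (∑ b, ‖y b‖ ^ 2)) + ∑ b, ‖y b‖ ^ 2 := by linarith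
    _ = (Real.sqrt (∑ b, ‖x b‖ ^ 2) + Real.sqrt (∑ b, ‖y b‖ ^ 2)) ^ 2 := by
        rw [add_sq, Real.sq_sqrt (by positivity), Real.sq_sqrt (by positivity)]; ring

omit [NeZero L] in
/-- `√Σ‖x‖² ≤ √Σ‖y‖² + √Σ‖x − y‖²`. [folklore] -/
private theorem sqrt_sum_norm_sq_le_add_sub {ι : Type*} [Fintype ι] {E : Type*} [SeminormedAddCommGroup E] (x y : ι → E) :
    Real.sqrt (∑ b, ‖x b‖ ^ 2) ≤ Real.sqrt (∑ b, ‖y b‖ ^ 2) + Real.sqrt (∑ b, ‖x b - y b‖ ^ 2) := by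
  have h := sqrt_sum_norm_add_sq_le y (fun b => x b - y b)
  simp only [add_sub_cancel] at h
  exact h

section OneStep

variable (P : Fin d → ℕ) {V : Type*} [NormedAddCommGroup V] [NormedSpace ℂ V]

/-- **THE FLAT ONE-STEP `Q′(1)` IS AN `ℓ²`-CONTRACTION BY `L^{−d∕2}`**: `Σ_y ‖(Q′(1)λ)(y)‖² ≤ L^{−d}·Σ_x ‖λ(x)‖²` — the block mean (`QprimeLin_flat_apply`),
Jensen on each block (`blockMean_norm_sq_le`, `|B(y)| = L^d`) and the block partition (`sum_blockOf_sum`). [cite: Balaban1985BackgroundPropagators, (3.19) p.393; Balaban1985Averaging, (2)–(4) pp.17–18] -/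
theorem sum_norm_sq_QprimeLin_flat_le (l : TSite d (fineP L P) → V) :
    ∑ y, ‖QprimeLin L P (fun _ : Bond d (fineP L P) => (LinearMap.id : V →ₗ[ℂ] V)) l y‖ ^ 2 ≤ ((L : ℝ) ^ d)⁻¹ * ∑ x, ‖l x‖ ^ 2 := by
  have hpt : ∀ y, ‖QprimeLin L P (fun _ : Bond d (fineP L P) => (LinearMap.id : V →ₗ[ℂ] V)) l y‖ ≤
      ((L : ℝ) ^ d)⁻¹ * ∑ x ∈ B9Eq319QprimeTorus.blockOf L P y, ‖l x‖ := fun y => by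
    rw [QprimeLin_flat_apply, Finset.mul_sum]
    refine (norm_sum_le _ _).trans (Finset.sum_le_sum fun x _ => ?_)
    rw [norm_smul, Real.norm_of_nonneg (by positivity)]
  calc ∑ y, ‖QprimeLin L P (fun _ : Bond d (fineP L P) => (LinearMap.id : V →ₗ[ℂ] V)) l y‖ ^ 2
      ≤ ∑ y, (((L : ℝ) ^ d)⁻¹ * ∑ x ∈ B9Eq319QprimeTorus.blockOf L P y, ‖l x‖) ^ 2 :=
        Finset.sum_le_sum fun y _ => pow_le_pow_left₀ (norm_nonneg _) (hpt y) 2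
    _ ≤ ∑ y, ((L : ℝ) ^ d)⁻¹ * ∑ x ∈ B9Eq319QprimeTorus.blockOf L P y, ‖l x‖ ^ 2 :=
        Finset.sum_le_sum fun y _ => blockMean_norm_sq_le L P l y
    _ = ((L : ℝ) ^ d)⁻¹ * ∑ x, ‖l x‖ ^ 2 := by rw [← Finset.mul_sum, sum_blockOf_sum]

end OneStep

/-! ## §2 The `ℓ²` telescoping along the tower: `E′_n ≤ Π_{j<n}(1 + ρ(ε_j)) − 1` -/

section Tower

variable (m : Fin d → ℕ) [∀ i, NeZero (m i)] {V : Type*} [NormedAddCommGroup V] [NormedSpace ℂ V]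

omit [∀ i, NeZero (m i)] in
/-- **THE FLAT COMPOSITE `Q′_n(1)` IS AN `ℓ²`-CONTRACTION BY `(√(L^{−d}))^n`** (§1 at every level torus; `QprimeTower_succ` definitionally).
[cite: Balaban1985BackgroundPropagators, (3.19) p.393; Balaban1985Averaging, (2)–(4) pp.17–18] -/
theorem sqrt_sum_norm_sq_QprimeTower_flat_le : ∀ (n : ℕ) (l : TSite d (towerP L m n) → V),
    Real.sqrt (∑ y : TSite d m, ‖QprimeTower L m (fun _ _ => (LinearMap.id : V →ₗ[ℂ] V)) n l y‖ ^ 2) ≤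
      (Real.sqrt (((L : ℝ) ^ d)⁻¹)) ^ n * Real.sqrt (∑ x : TSite d (towerP L m n), ‖l x‖ ^ 2)
  | 0, l => by
    rw [pow_zero, one_mul]
    exact le_of_eq (congrArg Real.sqrt (Finset.sum_congr rfl fun c _ => rfl))
  | n + 1, l => by
    set y : TSite d (towerP L m n) → V :=
      QprimeLin L (towerP L m n) (fun _ : Bond d (fineP L (towerP L m n)) => (LinearMap.id : V →ₗ[ℂ] V)) l with hy
    have e : ∀ c, QprimeTower L m (fun _ _ => (LinearMap.id : V →ₗ[ℂ] V)) (n + 1) l c =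
        QprimeTower L m (fun _ _ => (LinearMap.id : V →ₗ[ℂ] V)) n y c := fun c => rfl
    simp only [e]
    refine (sqrt_sum_norm_sq_QprimeTower_flat_le n y).trans ?_
    rw [pow_succ, mul_assoc]
    refine mul_le_mul_of_nonneg_left ?_ (by positivity)
    calc Real.sqrt (∑ b, ‖y b‖ ^ 2) ≤ Real.sqrt (((L : ℝ) ^ d)⁻¹ * ∑ b, ‖l b‖ ^ 2) :=
          Real.sqrt_le_sqrt (sum_norm_sq_QprimeLin_flat_le L (towerP L m n) l)
      _ = Real.sqrt (((L : ℝ) ^ d)⁻¹) * Real.sqrt (∑ b, ‖l b‖ ^ 2) := Real.sqrt_mul (by positivity) _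

omit [∀ i, NeZero (m i)] in
/-- **THE TOWER LETTER `ρ′_n` IN `ℓ²`, VOLUME-FREE**: for a level family of `ℂ`-linear bond transporters, the level-`j` ones `ε_j`-close to the identity,
`√(Σ_y ‖(Q′_n(R)λ − Q′_n(1)λ)(y)‖²) ≤ (Π_{j<n}(1 + ρ(ε_j)) − 1)·(√(L^{−d}))^n·√(Σ_x ‖λ(x)‖²)`, `ρ(ε) = (1+ε)^{d(L−1)} − 1` — the telescoping
`Q′_{n+1}(R) − Q′_{n+1}(1) = [Q′_n(R) − Q′_n(1)]∘Q′(R_n) + Q′_n(1)∘[Q′(R_n) − Q′(1)]` in `ℓ²` (Minkowski) with ne9-leaf-03's one-step Hilbert letter and §1: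
both level-`n` counts carry `L^{−d∕2}`, so `1 + E′_{n+1} ≤ (1 + E′_n)(1 + ρ(ε_n))`. [cite: Balaban1985BackgroundPropagators, (3.19) p.393, (3.35)–(3.37) p.396, p.403, (3.79)–(3.81) p.406; Balaban1985Averaging, (2)–(4) pp.17–18] -/
theorem sqrt_sum_norm_sq_QprimeTower_sub_id_le (Rlev : (n : ℕ) → Bond d (towerP L m (n + 1)) → V →ₗ[ℂ] V) (ε : ℕ → ℝ) (hε : ∀ n, 0 ≤ ε n)
    (hR : ∀ n b v, ‖Rlev n b v - v‖ ≤ ε n * ‖v‖) :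
    ∀ (n : ℕ) (l : TSite d (towerP L m n) → V),
      Real.sqrt (∑ y : TSite d m, ‖QprimeTower L m Rlev n l y - QprimeTower L m (fun _ _ => (LinearMap.id : V →ₗ[ℂ] V)) n l y‖ ^ 2) ≤
        ((∏ j ∈ Finset.range n, (1 + ((1 + ε j) ^ (d * (L - 1)) - 1))) - 1) *
          ((Real.sqrt (((L : ℝ) ^ d)⁻¹)) ^ n * Real.sqrt (∑ x : TSite d (towerP L m n), ‖l x‖ ^ 2))
  | 0, l => by simp
  | n + 1, l => by
    set θ : ℕ → ℝ := fun j => (1 + ε j) ^ (d * (L - 1)) - 1 with hθ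
    have hθ0 : ∀ j, 0 ≤ θ j := fun j => by rw [hθ]; exact rho_nonneg L (d := d) (hε j)
    set ρ : ℝ := Real.sqrt (((L : ℝ) ^ d)⁻¹) with hρ
    have hρ0 : 0 ≤ ρ := Real.sqrt_nonneg _
    have hP1 : ∀ n', (1 : ℝ) ≤ ∏ j ∈ Finset.range n', (1 + θ j) := fun n' =>
      Finset.one_le_prod (s := Finset.range n') fun j _ => by linarith [hθ0 j]
    set E : ℝ := (∏ j ∈ Finset.range n, (1 + θ j)) - 1 with hE
    have hE0 : 0 ≤ E := by rw [hE]; linarith [hP1 n]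
    -- the two level-`n` images and the recursion `Q′_{n+1} = Q′_n ∘ Q′(level n)` (definitional)
    set x : TSite d (towerP L m n) → V := QprimeLin L (towerP L m n) (Rlev n) l with hx
    set y : TSite d (towerP L m n) → V :=
      QprimeLin L (towerP L m n) (fun _ : Bond d (fineP L (towerP L m n)) => (LinearMap.id : V →ₗ[ℂ] V)) l with hy
    have hflat : Real.sqrt (∑ b, ‖y b‖ ^ 2) ≤ ρ * Real.sqrt (∑ b, ‖l b‖ ^ 2) := by
      calc Real.sqrt (∑ b, ‖y b‖ ^ 2) ≤ Real.sqrt (((L : ℝ) ^ d)⁻¹ * ∑ b, ‖l b‖ ^ 2) :=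
            Real.sqrt_le_sqrt (sum_norm_sq_QprimeLin_flat_le L (towerP L m n) l)
        _ = ρ * Real.sqrt (∑ b, ‖l b‖ ^ 2) := Real.sqrt_mul (by positivity) _
    have hdev : Real.sqrt (∑ b, ‖x b - y b‖ ^ 2) ≤ θ n * (ρ * Real.sqrt (∑ b, ‖l b‖ ^ 2)) := by
      have h := sum_norm_sq_QprimeLin_sub_flat_le L (towerP L m n) (Rlev n) (hε n) (hR n) l
      calc Real.sqrt (∑ b, ‖x b - y b‖ ^ 2) ≤ Real.sqrt (θ n ^ 2 * (((L : ℝ) ^ d)⁻¹ * ∑ b, ‖l b‖ ^ 2)) := Real.sqrt_le_sqrt h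
        _ = θ n * (ρ * Real.sqrt (∑ b, ‖l b‖ ^ 2)) := by
            rw [Real.sqrt_mul' _ (by positivity), Real.sqrt_sq (hθ0 n), Real.sqrt_mul (by positivity)]
    have ih := sqrt_sum_norm_sq_QprimeTower_sub_id_le Rlev ε hε hR n x
    have hfl := sqrt_sum_norm_sq_QprimeTower_flat_le L m n (x - y)
    have hsplit : ∀ c, QprimeTower L m Rlev (n + 1) l c - QprimeTower L m (fun _ _ => (LinearMap.id : V →ₗ[ℂ] V)) (n + 1) l c =
        (QprimeTower L m Rlev n x c - QprimeTower L m (fun _ _ => (LinearMap.id : V →ₗ[ℂ] V)) n x c) +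
          QprimeTower L m (fun _ _ => (LinearMap.id : V →ₗ[ℂ] V)) n (x - y) c := by
      intro c
      have e1 : QprimeTower L m Rlev (n + 1) l c = QprimeTower L m Rlev n x c := rfl
      have e2 : QprimeTower L m (fun _ _ => (LinearMap.id : V →ₗ[ℂ] V)) (n + 1) l c =
          QprimeTower L m (fun _ _ => (LinearMap.id : V →ₗ[ℂ] V)) n y c := rfl
      rw [e1, e2, map_sub, Pi.sub_apply]
      abel
    have hxy : Real.sqrt (∑ b, ‖x b‖ ^ 2) ≤ (1 + θ n) * (ρ * Real.sqrt (∑ b, ‖l b‖ ^ 2)) := by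
      have h := sqrt_sum_norm_sq_le_add_sub x y
      nlinarith [hflat, hdev]
    calc Real.sqrt (∑ c : TSite d m, ‖QprimeTower L m Rlev (n + 1) l c - QprimeTower L m (fun _ _ => (LinearMap.id : V →ₗ[ℂ] V)) (n + 1) l c‖ ^ 2)
        = Real.sqrt (∑ c : TSite d m, ‖(QprimeTower L m Rlev n x c - QprimeTower L m (fun _ _ => (LinearMap.id : V →ₗ[ℂ] V)) n x c) +
            QprimeTower L m (fun _ _ => (LinearMap.id : V →ₗ[ℂ] V)) n (x - y) c‖ ^ 2) := by
          congr 1; exact Finset.sum_congr rfl fun c _ => by rw [hsplit c]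
      _ ≤ Real.sqrt (∑ c : TSite d m, ‖QprimeTower L m Rlev n x c - QprimeTower L m (fun _ _ => (LinearMap.id : V →ₗ[ℂ] V)) n x c‖ ^ 2) +
          Real.sqrt (∑ c : TSite d m, ‖QprimeTower L m (fun _ _ => (LinearMap.id : V →ₗ[ℂ] V)) n (x - y) c‖ ^ 2) :=
          sqrt_sum_norm_add_sq_le _ _
      _ ≤ E * (ρ ^ n * Real.sqrt (∑ b, ‖x b‖ ^ 2)) + ρ ^ n * Real.sqrt (∑ b, ‖x b - y b‖ ^ 2) :=
          add_le_add ih (hfl.trans (le_of_eq (by rw [hρ]; simp only [Pi.sub_apply])))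
      _ ≤ E * (ρ ^ n * ((1 + θ n) * (ρ * Real.sqrt (∑ b, ‖l b‖ ^ 2)))) + ρ ^ n * (θ n * (ρ * Real.sqrt (∑ b, ‖l b‖ ^ 2))) := by
          gcongr
      _ = ((∏ j ∈ Finset.range (n + 1), (1 + θ j)) - 1) * (ρ ^ (n + 1) * Real.sqrt (∑ b, ‖l b‖ ^ 2)) := by
          rw [Finset.prod_range_succ, hE, pow_succ]; ring

end Tower

/-! ## §3 The reading on the chain's carrier `QprimeTowerW` -/

section Readings

/-- `Π_{j<n}(1 + t_j) ≤ exp(Σ_{j<n} t_j)` for `t_j ≥ 0`. [folklore] -/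
private theorem prod_one_add_le_exp_sum (t : ℕ → ℝ) (ht : ∀ j, 0 ≤ t j) (n : ℕ) :
    ∏ j ∈ Finset.range n, (1 + t j) ≤ Real.exp (∑ j ∈ Finset.range n, t j) := by
  rw [Real.exp_sum]
  exact Finset.prod_le_prod (fun j _ => by linarith [ht j]) fun j _ => by linarith [Real.add_one_le_exp (t j)]

/-- `Σ_{j<n} s·r^j ≤ s∕(1−r)` for `0 ≤ r < 1`, `0 ≤ s`. [folklore] -/
private theorem sum_geometric_le (s r : ℝ) (hs : 0 ≤ s) (hr0 : 0 ≤ r) (hr1 : r < 1) (n : ℕ) :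
    ∑ j ∈ Finset.range n, s * r ^ j ≤ s / (1 - r) := by
  rw [← Finset.mul_sum, div_eq_mul_one_div]
  refine mul_le_mul_of_nonneg_left ?_ hs
  have h := geom_sum_Ico_le_of_lt_one (m := 0) (n := n) hr0 hr1
  rw [pow_zero] at h
  rwa [Finset.range_eq_Ico]

omit [NeZero L] in
/-- `(√a)^n = √(a^n)` for `a ≥ 0`. [folklore] -/
private theorem sqrt_pow_eq {a : ℝ} (ha : 0 ≤ a) : ∀ n : ℕ, (Real.sqrt a) ^ n = Real.sqrt (a ^ n)
  | 0 => by simp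
  | n + 1 => by rw [pow_succ, sqrt_pow_eq ha n, pow_succ, Real.sqrt_mul (pow_nonneg ha n)]

variable {𝔸 : Type*} [NormedRing 𝔸] [NormedAlgebra ℂ 𝔸] [CompleteSpace 𝔸] [NormOneClass 𝔸]
  (m : Fin d → ℕ) [∀ i, NeZero (m i)] (n : ℕ)
  {W : Type*} [NormedAddCommGroup W] [InnerProductSpace ℂ W] (φ : W ≃ₗ[ℂ] 𝔸) {Mφ Mφ' : ℝ} (hMφ : 0 ≤ Mφ) (hMφ' : 0 ≤ Mφ')
  (hφ : ∀ w, ‖φ w‖ ≤ Mφ * ‖w‖) (hφ' : ∀ X, ‖φ.symm X‖ ≤ Mφ' * ‖X‖) {c₀ : ℝ} [Fact (0 < c₀)]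
  (U : Bond d (towerP L m (n + 1)) → 𝔸ˣ) (εU : ℕ → ℝ) (hεU : ∀ j, 0 ≤ εU j)
  (hUε : ∀ (j : ℕ) (b : Bond d (towerP L m (j + 1))), ‖(UlevOf L m (n + 1) U j b : 𝔸) - 1‖ ≤ εU j)
  (hUb : ∀ (j : ℕ) (b : Bond d (towerP L m (j + 1))), UlevOf L m (n + 1) U j b ∈ U1 𝔸)

include hφ hφ' hMφ hMφ' hεU hUε hUb in
/-- **THE TOWER LETTER `ρ′_k` ON THE CHAIN's CARRIER, `ℓ²` CURRENCY, VOLUME-FREE**: the coarse `ℓ²` norm of the SAME difference that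
`B9Eq315QTowerLipschitz.norm_QprimeTowerW_sub_flat_le` bounds in sup norm:
`√(Σ_y ‖(Q′_{n+1}(U)λ − Q′_{n+1}(1)λ)(y)‖²) ≤ (Π_{j≤n}(1 + 2M_φM_φ′ε_j)^{d(L−1)} − 1)·√((c₀·(L^{n+1})^d)⁻¹)·‖λ‖_{L²(c₀)}` — the transporters `R(Ū^j(b))`
are `2M_φM_φ′ε_j`-close to the identity (`norm_adTransportW_sub_le`); `√((c₀L^{kd})⁻¹) = 1` along (3.11)∕(3.16). NO `(√c₀)⁻¹`, NO `#T`.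
[cite: Balaban1985BackgroundPropagators, (3.19) p.393, (3.11) p.392, (3.35)–(3.37) p.396, p.403, (3.79)–(3.81) p.406] -/
theorem sqrt_sum_norm_sq_QprimeTowerW_sub_flat_le (l : SiteL2K ℂ d (towerP L m (n + 1)) c₀ W) :
    Real.sqrt (∑ y : TSite d m, ‖QprimeTowerW L m n φ U (c₀ := c₀) l y -
        QprimeTowerW L m n φ (fun _ : Bond d (towerP L m (n + 1)) => (1 : 𝔸ˣ)) (c₀ := c₀) l y‖ ^ 2) ≤
      ((∏ j ∈ Finset.range (n + 1), (1 + 2 * Mφ * Mφ' * εU j) ^ (d * (L - 1))) - 1) *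
        (Real.sqrt ((c₀ * ((L : ℝ) ^ (n + 1)) ^ d)⁻¹) * ‖l‖) := by
  have hc₀ : 0 < c₀ := Fact.out
  have hL0 : (0 : ℝ) < L := by exact_mod_cast Nat.pos_of_ne_zero (NeZero.ne L)
  have hε : ∀ j, 0 ≤ 2 * Mφ * Mφ' * εU j := fun j => by have := hεU j; positivity
  have hR : ∀ (j : ℕ) (b : Bond d (towerP L m (j + 1))) (v : W),
      ‖adTransportW φ (UlevOf L m (n + 1) U j) b v - v‖ ≤ 2 * Mφ * Mφ' * εU j * ‖v‖ :=
    fun j b v => norm_adTransportW_sub_le φ hφ hφ' hMφ' _ b (hUb j b) (hUε j b) v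
  have hflat : (fun j => adTransportW φ (UlevOf L m (n + 1) (fun _ : Bond d (towerP L m (n + 1)) => (1 : 𝔸ˣ)) j)) =
      fun _ _ => (LinearMap.id : W →ₗ[ℂ] W) := by
    funext j b; rw [UlevOf_one, adTransportW_one]
  -- the underlying fine function and its `ℓ²` mass: `Σ_x ‖λ x‖² = ‖λ‖² ∕ c₀`
  set lf : TSite d (towerP L m (n + 1)) → W := WL2.linearEquiv ℂ ℂ (fun _ : TSite d (towerP L m (n + 1)) => c₀) l with hlf
  have hmass : Real.sqrt (∑ x, ‖lf x‖ ^ 2) = (Real.sqrt c₀)⁻¹ * ‖l‖ := by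
    have hn : ‖l‖ ^ 2 = ∑ x, c₀ * ‖WL2.equiv ℂ (fun _ : TSite d (towerP L m (n + 1)) => c₀) W l x‖ ^ 2 :=
      WL2.norm_sq (𝕜 := ℂ) (w := fun _ : TSite d (towerP L m (n + 1)) => c₀) (V := W) l
    have hsum : ∑ x, ‖lf x‖ ^ 2 = c₀⁻¹ * ‖l‖ ^ 2 := by
      rw [hn, Finset.mul_sum]
      refine Finset.sum_congr rfl fun x _ => ?_
      rw [hlf]; field_simp; rfl
    rw [hsum, Real.sqrt_mul (inv_nonneg.2 hc₀.le), Real.sqrt_inv, Real.sqrt_sq (norm_nonneg _)]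
  have htel := sqrt_sum_norm_sq_QprimeTower_sub_id_le L m (fun j => adTransportW φ (UlevOf L m (n + 1) U j))
    (fun j => 2 * Mφ * Mφ' * εU j) hε hR (n + 1) lf
  -- identify the two sides with `QprimeTowerW`
  have hU' : ∀ y, QprimeTowerW L m n φ U (c₀ := c₀) l y = QprimeTower L m (fun j => adTransportW φ (UlevOf L m (n + 1) U j)) (n + 1) lf y :=
    fun y => rfl
  have h1' : ∀ y, QprimeTowerW L m n φ (fun _ : Bond d (towerP L m (n + 1)) => (1 : 𝔸ˣ)) (c₀ := c₀) l y =
      QprimeTower L m (fun _ _ => (LinearMap.id : W →ₗ[ℂ] W)) (n + 1) lf y := fun y => by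
    rw [QprimeTowerW, hflat]; rfl
  simp only [hU', h1']
  refine htel.trans (le_of_eq ?_)
  -- `ρ(2M_φM_φ′ε_j) + 1 = (1 + 2M_φM_φ′ε_j)^{d(L−1)}`; `(√(L^{−d}))^{n+1}·(√c₀)⁻¹ = √((c₀(L^{n+1})^d)⁻¹)`
  have hprod : ∏ j ∈ Finset.range (n + 1), (1 + ((1 + 2 * Mφ * Mφ' * εU j) ^ (d * (L - 1)) - 1)) =
      ∏ j ∈ Finset.range (n + 1), (1 + 2 * Mφ * Mφ' * εU j) ^ (d * (L - 1)) :=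
    Finset.prod_congr rfl fun j _ => by ring
  have hρ : (Real.sqrt (((L : ℝ) ^ d)⁻¹)) ^ (n + 1) * (Real.sqrt c₀)⁻¹ = Real.sqrt ((c₀ * ((L : ℝ) ^ (n + 1)) ^ d)⁻¹) := by
    rw [sqrt_pow_eq (by positivity : (0:ℝ) ≤ ((L : ℝ) ^ d)⁻¹) (n + 1), ← Real.sqrt_inv, ← Real.sqrt_mul (by positivity), mul_inv,
      mul_comm (c₀⁻¹)]
    congr 1
    rw [inv_pow, ← pow_mul, ← pow_mul, Nat.mul_comm d (n + 1)]
  rw [hprod, hmass, ← mul_assoc ((Real.sqrt (((L : ℝ) ^ d)⁻¹)) ^ (n + 1)), hρ]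

include hφ hφ' hMφ hMφ' hεU hUε hUb in
/-- **… UNDER THE ε-PROFILE: FREE OF THE NUMBER OF LEVELS AND OF EVERY VOLUME** — if `ε_j ≤ ε⋆r^j` for the levels `j < n+1` (`0 ≤ r < 1`, `0 ≤ ε⋆`):
`√(Σ_y ‖(Q′_k(U)λ − Q′_k(1)λ)(y)‖²) ≤ (exp(d(L−1)·2M_φM_φ′·ε⋆∕(1−r)) − 1)·√((c₀L^{kd})⁻¹)·‖λ‖_{L²(c₀)}` — cf. the profile file's
`norm_QprimeTowerW_sub_flat_le_geometric` (sup output, factor `(√c₀)⁻¹ = L^{kd∕2}` along (3.11)), whose `ℓ²` twin this is.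
[cite: Balaban1985BackgroundPropagators, (3.19) p.393, (3.35)–(3.37) p.396, (3.79)–(3.81) p.406; Balaban1985Averaging, Prop. 2 (52)–(54) p.26] -/
theorem sqrt_sum_norm_sq_QprimeTowerW_sub_flat_le_geometric {r εs : ℝ} (hr0 : 0 ≤ r) (hr1 : r < 1) (hεs : 0 ≤ εs)
    (hεg : ∀ j < n + 1, εU j ≤ εs * r ^ j) (l : SiteL2K ℂ d (towerP L m (n + 1)) c₀ W) :
    Real.sqrt (∑ y : TSite d m, ‖QprimeTowerW L m n φ U (c₀ := c₀) l y -
        QprimeTowerW L m n φ (fun _ : Bond d (towerP L m (n + 1)) => (1 : 𝔸ˣ)) (c₀ := c₀) l y‖ ^ 2) ≤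
      (Real.exp ((d * (L - 1) : ℕ) * (2 * Mφ * Mφ' * εs / (1 - r))) - 1) * (Real.sqrt ((c₀ * ((L : ℝ) ^ (n + 1)) ^ d)⁻¹) * ‖l‖) := by
  have base := sqrt_sum_norm_sq_QprimeTowerW_sub_flat_le L m n φ hMφ hMφ' hφ hφ' (c₀ := c₀) U εU hεU hUε hUb l
  have ht : ∀ j, (0 : ℝ) ≤ 2 * Mφ * Mφ' * εU j := fun j => by have := hεU j; positivity
  have ht' : ∀ j, (0 : ℝ) ≤ 2 * Mφ * Mφ' * εs * r ^ j := fun j => by positivity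
  have htt' : ∀ j ∈ Finset.range (n + 1), 2 * Mφ * Mφ' * εU j ≤ 2 * Mφ * Mφ' * εs * r ^ j := fun j hj => by
    have h := mul_le_mul_of_nonneg_left (hεg j (Finset.mem_range.1 hj)) (by positivity : (0 : ℝ) ≤ 2 * Mφ * Mφ')
    linarith [h]
  have hP : ∏ j ∈ Finset.range (n + 1), (1 + 2 * Mφ * Mφ' * εU j) ^ (d * (L - 1)) ≤
      Real.exp ((d * (L - 1) : ℕ) * (2 * Mφ * Mφ' * εs / (1 - r))) := by
    rw [Finset.prod_pow, Real.exp_nat_mul]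
    have h1 : ∏ j ∈ Finset.range (n + 1), (1 + 2 * Mφ * Mφ' * εU j) ≤ Real.exp (2 * Mφ * Mφ' * εs / (1 - r)) :=
      calc ∏ j ∈ Finset.range (n + 1), (1 + 2 * Mφ * Mφ' * εU j)
          ≤ ∏ j ∈ Finset.range (n + 1), (1 + 2 * Mφ * Mφ' * εs * r ^ j) :=
            Finset.prod_le_prod (fun j _ => by linarith [ht j]) fun j hj => by linarith [htt' j hj]
        _ ≤ Real.exp (∑ j ∈ Finset.range (n + 1), 2 * Mφ * Mφ' * εs * r ^ j) := prod_one_add_le_exp_sum _ ht' (n + 1)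
        _ ≤ Real.exp (2 * Mφ * Mφ' * εs / (1 - r)) :=
            Real.exp_le_exp.2 (sum_geometric_le (2 * Mφ * Mφ' * εs) r (by positivity) hr0 hr1 (n + 1))
    exact pow_le_pow_left₀ (Finset.prod_nonneg fun j _ => by linarith [ht j]) h1 _
  have hl0 : 0 ≤ Real.sqrt ((c₀ * ((L : ℝ) ^ (n + 1)) ^ d)⁻¹) * ‖l‖ := by positivity
  exact base.trans (mul_le_mul_of_nonneg_right (by linarith [hP]) hl0)

end Readings

/-! ## §4 The weight-`c₁` readings: the letters `θ_Q`, `M_Q` of `Q̃′_k(U) := (L²(c₁)-bundling) ∘ Q′_k(U)` (the NE9 owner g85's W-3 shapes — the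
k-level twins of `B9Eq325RLipschitzResolvent.norm_Qtilde_sub_Qtilde_le` ∕ `norm_Qtilde_one_le`, one background against the flat one) -/

section Qtilde

variable {𝔸 : Type*} [NormedRing 𝔸] [NormedAlgebra ℂ 𝔸] [CompleteSpace 𝔸] [NormOneClass 𝔸]
  (m : Fin d → ℕ) [∀ i, NeZero (m i)] (n : ℕ)
  {W : Type*} [NormedAddCommGroup W] [InnerProductSpace ℂ W] (φ : W ≃ₗ[ℂ] 𝔸) {Mφ Mφ' : ℝ} (hMφ : 0 ≤ Mφ) (hMφ' : 0 ≤ Mφ')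
  (hφ : ∀ w, ‖φ w‖ ≤ Mφ * ‖w‖) (hφ' : ∀ X, ‖φ.symm X‖ ≤ Mφ' * ‖X‖) {c₀ : ℝ} [Fact (0 < c₀)] (c₁ : ℝ) [Fact (0 < c₁)]
  (U : Bond d (towerP L m (n + 1)) → 𝔸ˣ) (εU : ℕ → ℝ) (hεU : ∀ j, 0 ≤ εU j)
  (hUε : ∀ (j : ℕ) (b : Bond d (towerP L m (j + 1))), ‖(UlevOf L m (n + 1) U j b : 𝔸) - 1‖ ≤ εU j)
  (hUb : ∀ (j : ℕ) (b : Bond d (towerP L m (j + 1))), UlevOf L m (n + 1) U j b ∈ U1 𝔸)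

omit [NeZero L] [∀ i, NeZero (m i)] in
/-- the weight-`c₁` norm of a bundled coarse function is `√c₁·√Σ_y‖f y‖²`. [cite: Balaban1985BackgroundPropagators, (3.11) p.392] -/
private theorem norm_bundle_eq (f : TSite d m → W) :
    ‖(WL2.linearEquiv ℂ ℂ (fun _ : TSite d m => c₁)).symm f‖ = Real.sqrt c₁ * Real.sqrt (∑ y, ‖f y‖ ^ 2) := by
  have hc₁ : 0 < c₁ := Fact.out
  have h := WL2.norm_sq (𝕜 := ℂ) (w := fun _ : TSite d m => c₁) (V := W) ((WL2.linearEquiv ℂ ℂ (fun _ : TSite d m => c₁)).symm f)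
  have h' : ‖(WL2.linearEquiv ℂ ℂ (fun _ : TSite d m => c₁)).symm f‖ ^ 2 = c₁ * ∑ y, ‖f y‖ ^ 2 := by
    rw [h, Finset.mul_sum]; rfl
  rw [← Real.sqrt_mul hc₁.le, ← h', Real.sqrt_sq (norm_nonneg _)]

include hφ hφ' hMφ hMφ' hεU hUε hUb in
/-- **THE LETTER `θ_Q` OF THE k-LEVEL `Q̃′_k` IN THE WEIGHT-`c₁` CURRENCY** (the owner g85's W-3 shape; k-level twin of
`B9Eq325RLipschitzResolvent.norm_Qtilde_sub_Qtilde_le` at `U′ = 1`): `‖Q̃′_{n+1}(U)λ − Q̃′_{n+1}(1)λ‖_{c₁} ≤ (Π_{j≤n}(1 + 2M_φM_φ′ε_j)^{d(L−1)} − 1)·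
√(c₁∕(c₀(L^{n+1})^d))·‖λ‖_{c₀}` — `√(c₁∕(c₀L^{kd})) = (ηL^k)⁻¹` along (3.16): NO volume, NO `(√c₀)⁻¹`. [cite: Balaban1985BackgroundPropagators, (3.19) p.393, (3.11) p.392, p.403, (3.79)–(3.81) p.406] -/
theorem norm_QtildeTower_sub_flat_le (l : SiteL2K ℂ d (towerP L m (n + 1)) c₀ W) :
    ‖((WL2.linearEquiv ℂ ℂ (fun _ : TSite d m => c₁)).symm.toLinearMap ∘ₗ QprimeTowerW L m n φ U (c₀ := c₀)) l -
        ((WL2.linearEquiv ℂ ℂ (fun _ : TSite d m => c₁)).symm.toLinearMap ∘ₗ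
          QprimeTowerW L m n φ (fun _ : Bond d (towerP L m (n + 1)) => (1 : 𝔸ˣ)) (c₀ := c₀)) l‖ ≤
      ((∏ j ∈ Finset.range (n + 1), (1 + 2 * Mφ * Mφ' * εU j) ^ (d * (L - 1))) - 1) *
        Real.sqrt (c₁ / (c₀ * ((L : ℝ) ^ (n + 1)) ^ d)) * ‖l‖ := by
  have hc₀ : 0 < c₀ := Fact.out
  have hc₁ : 0 < c₁ := Fact.out
  have hL0 : (0 : ℝ) < L := by exact_mod_cast Nat.pos_of_ne_zero (NeZero.ne L)
  have hP0 : 0 ≤ (∏ j ∈ Finset.range (n + 1), (1 + 2 * Mφ * Mφ' * εU j) ^ (d * (L - 1))) - 1 :=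
    sub_nonneg.2 (Finset.one_le_prod (s := Finset.range (n + 1)) fun j _ => one_le_pow₀ (by
      have h0 : 0 ≤ 2 * Mφ * Mφ' * εU j := by have := hεU j; positivity
      linarith))
  simp only [LinearMap.comp_apply, LinearEquiv.coe_toLinearMap]
  rw [← map_sub, norm_bundle_eq]
  have h := sqrt_sum_norm_sq_QprimeTowerW_sub_flat_le L m n φ hMφ hMφ' hφ hφ' (c₀ := c₀) U εU hεU hUε hUb l
  have h' : Real.sqrt (∑ y, ‖(QprimeTowerW L m n φ U (c₀ := c₀) l -
      QprimeTowerW L m n φ (fun _ : Bond d (towerP L m (n + 1)) => (1 : 𝔸ˣ)) (c₀ := c₀) l) y‖ ^ 2) ≤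
      ((∏ j ∈ Finset.range (n + 1), (1 + 2 * Mφ * Mφ' * εU j) ^ (d * (L - 1))) - 1) *
        (Real.sqrt ((c₀ * ((L : ℝ) ^ (n + 1)) ^ d)⁻¹) * ‖l‖) := by simpa only [Pi.sub_apply] using h
  have hs : Real.sqrt c₁ * Real.sqrt ((c₀ * ((L : ℝ) ^ (n + 1)) ^ d)⁻¹) = Real.sqrt (c₁ / (c₀ * ((L : ℝ) ^ (n + 1)) ^ d)) := by
    rw [← Real.sqrt_mul hc₁.le, div_eq_mul_inv]
  calc Real.sqrt c₁ * Real.sqrt (∑ y, ‖(QprimeTowerW L m n φ U (c₀ := c₀) l -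
          QprimeTowerW L m n φ (fun _ : Bond d (towerP L m (n + 1)) => (1 : 𝔸ˣ)) (c₀ := c₀) l) y‖ ^ 2)
      ≤ Real.sqrt c₁ * (((∏ j ∈ Finset.range (n + 1), (1 + 2 * Mφ * Mφ' * εU j) ^ (d * (L - 1))) - 1) *
          (Real.sqrt ((c₀ * ((L : ℝ) ^ (n + 1)) ^ d)⁻¹) * ‖l‖)) := mul_le_mul_of_nonneg_left h' (Real.sqrt_nonneg _)
    _ = ((∏ j ∈ Finset.range (n + 1), (1 + 2 * Mφ * Mφ' * εU j) ^ (d * (L - 1))) - 1) *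
          (Real.sqrt c₁ * Real.sqrt ((c₀ * ((L : ℝ) ^ (n + 1)) ^ d)⁻¹)) * ‖l‖ := by ring
    _ = _ := by rw [hs]

omit [NormOneClass 𝔸] in
/-- **THE FLAT LETTER `M_Q(1)` OF THE k-LEVEL `Q̃′_k` IN THE WEIGHT-`c₁` CURRENCY** (k-level twin of `B9Eq325RLipschitzResolvent.norm_Qtilde_one_le`):
`‖Q̃′_{n+1}(1)λ‖_{c₁} ≤ √(c₁∕(c₀(L^{n+1})^d))·‖λ‖_{c₀}` — the flat composite is an `ℓ²`-contraction by `(√(L^{−d}))^{n+1}` (§2); `= ‖λ‖` on the diagonal.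
[cite: Balaban1985BackgroundPropagators, (3.19) p.393, (3.11) p.392; Balaban1985Averaging, (2)–(4) pp.17–18] -/
theorem norm_QtildeTower_one_le (l : SiteL2K ℂ d (towerP L m (n + 1)) c₀ W) :
    ‖((WL2.linearEquiv ℂ ℂ (fun _ : TSite d m => c₁)).symm.toLinearMap ∘ₗ
        QprimeTowerW L m n φ (fun _ : Bond d (towerP L m (n + 1)) => (1 : 𝔸ˣ)) (c₀ := c₀)) l‖ ≤
      Real.sqrt (c₁ / (c₀ * ((L : ℝ) ^ (n + 1)) ^ d)) * ‖l‖ := by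
  have hc₀ : 0 < c₀ := Fact.out
  have hc₁ : 0 < c₁ := Fact.out
  have hL0 : (0 : ℝ) < L := by exact_mod_cast Nat.pos_of_ne_zero (NeZero.ne L)
  simp only [LinearMap.comp_apply, LinearEquiv.coe_toLinearMap]
  rw [norm_bundle_eq]
  have hflat : (fun j => adTransportW φ (UlevOf L m (n + 1) (fun _ : Bond d (towerP L m (n + 1)) => (1 : 𝔸ˣ)) j)) =
      fun _ _ => (LinearMap.id : W →ₗ[ℂ] W) := by
    funext j b; rw [UlevOf_one, adTransportW_one]
  set lf : TSite d (towerP L m (n + 1)) → W := WL2.linearEquiv ℂ ℂ (fun _ : TSite d (towerP L m (n + 1)) => c₀) l with hlf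
  have hmass : Real.sqrt (∑ x, ‖lf x‖ ^ 2) = (Real.sqrt c₀)⁻¹ * ‖l‖ := by
    have hn : ‖l‖ ^ 2 = ∑ x, c₀ * ‖WL2.equiv ℂ (fun _ : TSite d (towerP L m (n + 1)) => c₀) W l x‖ ^ 2 :=
      WL2.norm_sq (𝕜 := ℂ) (w := fun _ : TSite d (towerP L m (n + 1)) => c₀) (V := W) l
    have hsum : ∑ x, ‖lf x‖ ^ 2 = c₀⁻¹ * ‖l‖ ^ 2 := by
      rw [hn, Finset.mul_sum]
      refine Finset.sum_congr rfl fun x _ => ?_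
      rw [hlf]; field_simp; rfl
    rw [hsum, Real.sqrt_mul (inv_nonneg.2 hc₀.le), Real.sqrt_inv, Real.sqrt_sq (norm_nonneg _)]
  have h1' : ∀ y, QprimeTowerW L m n φ (fun _ : Bond d (towerP L m (n + 1)) => (1 : 𝔸ˣ)) (c₀ := c₀) l y =
      QprimeTower L m (fun _ _ => (LinearMap.id : W →ₗ[ℂ] W)) (n + 1) lf y := fun y => by
    rw [QprimeTowerW, hflat]; rfl
  simp only [h1']
  have h := sqrt_sum_norm_sq_QprimeTower_flat_le L m (n + 1) lf
  have hρ : (Real.sqrt (((L : ℝ) ^ d)⁻¹)) ^ (n + 1) * (Real.sqrt c₀)⁻¹ = Real.sqrt ((c₀ * ((L : ℝ) ^ (n + 1)) ^ d)⁻¹) := by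
    rw [sqrt_pow_eq (by positivity : (0:ℝ) ≤ ((L : ℝ) ^ d)⁻¹) (n + 1), ← Real.sqrt_inv, ← Real.sqrt_mul (by positivity), mul_inv,
      mul_comm (c₀⁻¹)]
    congr 1
    rw [inv_pow, ← pow_mul, ← pow_mul, Nat.mul_comm d (n + 1)]
  have hs : Real.sqrt c₁ * Real.sqrt ((c₀ * ((L : ℝ) ^ (n + 1)) ^ d)⁻¹) = Real.sqrt (c₁ / (c₀ * ((L : ℝ) ^ (n + 1)) ^ d)) := by
    rw [← Real.sqrt_mul hc₁.le, div_eq_mul_inv]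
  calc Real.sqrt c₁ * Real.sqrt (∑ y, ‖QprimeTower L m (fun _ _ => (LinearMap.id : W →ₗ[ℂ] W)) (n + 1) lf y‖ ^ 2)
      ≤ Real.sqrt c₁ * ((Real.sqrt (((L : ℝ) ^ d)⁻¹)) ^ (n + 1) * Real.sqrt (∑ x, ‖lf x‖ ^ 2)) :=
        mul_le_mul_of_nonneg_left h (Real.sqrt_nonneg _)
    _ = Real.sqrt c₁ * ((Real.sqrt (((L : ℝ) ^ d)⁻¹)) ^ (n + 1) * (Real.sqrt c₀)⁻¹) * ‖l‖ := by rw [hmass]; ring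
    _ = Real.sqrt (c₁ / (c₀ * ((L : ℝ) ^ (n + 1)) ^ d)) * ‖l‖ := by rw [hρ, hs]

end Qtilde

end Literature.MathematicalPhysics.QuantumFieldTheory.Balaban1983to89.B9Eq319QprimeTowerLipschitzL2

end
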